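import Literature.NumberTheory.LFunctions.Zhang2022.RepairSlopeArith
import Literature.NumberTheory.LFunctions.Zhang2022.RepairSection9Boxes

/-!
# Zhang (2022) §18-margin repair rung: slope (centred-form) mirrors of the §8/§9 pair block

Trunk T-ANT (NumberTheory/LFunctions). Companion of `RepairSlopeArith.lean` (slope forms
`SFI`/`SCB`) and `RepairSection9Boxes.lean` (closed forms `bDiagVal`, `bCrossYVal`, `bCrossXVal`
of the §8/§9 constants of Y. Zhang, arXiv:2211.02515v1 [Zhang2022LandauSiegel], (8.19)–(8.23),
(9.3)–(9.7), as functions of the lengths). For the LOCAL cover annex (D-0077) each matrix entry must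
be enclosed over a cell of lengths with FIRST-ORDER accuracy; this file mirrors the closed forms in
slope arithmetic, in one active real variable `t` (a cell coordinate; every length is a slope form
in `t`, e.g. on the tie line `ν₁ = t`, `ν₂ = ½`, `ν₃ = ¾ − t/2`):

* `SCB.Mem.congr` (pointwise rewriting of the function under a slope form);
* slope mirrors with soundness lemmas: `P0S`, `P1S`, `P2S`, `PzS`, `expQuadIntS`, `polyIntS`
  (`smem_…`), `FGintS`, `shiftRS`, `shiftUS`, `FGXintS`, `FGYintS`, and the block
  `bDiagValS`, `bCrossYValS`, `bCrossXValS`, `cDiagS`, `cCrossS` (`smem_cDiagS`: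
  a slope form of `t ↦ cDiag k (ν(t))` from a slope form of `ν`, etc.);
* every mirror takes the cell `T` and its rational centre `c` (needed by the oscillatory rule).

No statement about the manuscript's Theorems 1–2; no facts, no axioms beyond the standard three.
-/

noncomputable section

open Complex Real ComplexConjugate
open Literature.Analysis.ValidatedNumerics.Numerics

namespace Literature.NumberTheory.LFunctions.Zhang2022

variable {T : FI} {c : ℚ}

/-- A slope form of `f` is a slope form of any pointwise-equal `g`. [cite: Moore1966, §4.4] -/
theorem SCB.Mem.congr {f g : ℝ → ℂ} {Z : SCB} (h : SCB.Mem T c f Z) (hfg : ∀ t, g t = f t) :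
    SCB.Mem T c g Z := by
  refine ⟨fun t ht => ?_, ?_, fun t ht => ?_⟩
  · rw [hfg]; exact h.1 t ht
  · rw [hfg]; exact h.2.1
  · obtain ⟨s, hs, es⟩ := h.2.2 t ht
    exact ⟨s, hs, by rw [hfg, hfg, es]⟩

/-- A real slope form of `a` is one of any pointwise-equal `b`. [cite: Moore1966, §4.4] -/
theorem SFI.Mem.congr {a b : ℝ → ℝ} {A : SFI} (h : SFI.Mem T c a A) (hab : ∀ t, b t = a t) :
    SFI.Mem T c b A := by
  refine ⟨fun t ht => ?_, ?_, fun t ht => ?_⟩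
  · rw [hab]; exact h.1 t ht
  · rw [hab]; exact h.2.1
  · obtain ⟨s, hs, es⟩ := h.2.2 t ht
    exact ⟨s, hs, by rw [hab, hab, es]⟩

/- Keep the interval primitives opaque to the elaborator's unifier. -/
attribute [local irreducible] CB.add CB.sub CB.mul CB.neg CB.conj CB.mulFI CB.mulI CB.mulInt
  CB.ofFI CB.ofInt CB.normSqFI CB.expI FI.add FI.sub FI.mul FI.neg FI.mulInt FI.divNat FI.divPos
  FI.ofRat FI.ofInt FI.pi qCB piMul expIpi overPiFI piISq mulPiFI scaleRatFI recipFI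
  recipMulPiFI expIpiFI

/-! ### The antiderivative polynomials and the two integral shapes -/

/-- slope mirror of `P0` [cite: Zhang2022LandauSiegel, §8 (8.13)–(8.22)] -/
def P0S (Q0 Q1 Q2 : SCB) (U : SFI) : SCB :=
  (((Q0.mulR U).mulI).neg).add ((Q1.mulR (U.mul U)).add (((Q2.mulR ((U.mul U).mul U)).mulI).mulInt 2))
/-- slope mirror of `P1` [cite: Zhang2022LandauSiegel, §8 (8.13)–(8.22)] -/
def P1S (Q1 Q2 : SCB) (U : SFI) : SCB := (((Q1.mulR U).mulI).neg).add ((Q2.mulR (U.mul U)).mulInt 2)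
/-- slope mirror of `P2` [cite: Zhang2022LandauSiegel, §8 (8.13)–(8.22)] -/
def P2S (Q2 : SCB) (U : SFI) : SCB := ((Q2.mulR U).mulI).neg
/-- slope mirror of `Pz` [cite: Zhang2022LandauSiegel, §8 (8.13)–(8.22)] -/
def PzS (Q0 Q1 Q2 : SCB) (U Z : SFI) : SCB :=
  ((P0S Q0 Q1 Q2 U).add ((P1S Q1 Q2 U).mulR Z)).add ((P2S Q2 U).mulR (Z.mul Z))

variable {q0 q1 q2 : ℝ → ℂ} {Q0 Q1 Q2 : SCB} {u z l s : ℝ → ℝ} {U Z L S : SFI}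

/-- soundness of `P0S` [cite: Moore1966, §4.4] -/
theorem smem_P0 (h0 : SCB.Mem T c q0 Q0) (h1 : SCB.Mem T c q1 Q1) (h2 : SCB.Mem T c q2 Q2)
    (hu : SFI.Mem T c u U) :
    SCB.Mem T c (fun t => P0 (q0 t) (q1 t) (q2 t) (u t)) (P0S Q0 Q1 Q2 U) := by
  have h := SCB.mem_add (SCB.mem_neg (SCB.mem_mulI (SCB.mem_mulR h0 hu)))
    (SCB.mem_add (SCB.mem_mulR h1 (SFI.mem_mul hu hu))
      (SCB.mem_mulInt (SCB.mem_mulI (SCB.mem_mulR h2 (SFI.mem_mul (SFI.mem_mul hu hu) hu))) 2))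
  exact h.congr fun t => by unfold P0; push_cast; ring

/-- soundness of `P1S` [cite: Moore1966, §4.4] -/
theorem smem_P1 (h1 : SCB.Mem T c q1 Q1) (h2 : SCB.Mem T c q2 Q2) (hu : SFI.Mem T c u U) :
    SCB.Mem T c (fun t => P1 (q1 t) (q2 t) (u t)) (P1S Q1 Q2 U) := by
  have h := SCB.mem_add (SCB.mem_neg (SCB.mem_mulI (SCB.mem_mulR h1 hu)))
    (SCB.mem_mulInt (SCB.mem_mulR h2 (SFI.mem_mul hu hu)) 2)
  exact h.congr fun t => by unfold P1; push_cast; ring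

/-- soundness of `P2S` [cite: Moore1966, §4.4] -/
theorem smem_P2 (h2 : SCB.Mem T c q2 Q2) (hu : SFI.Mem T c u U) :
    SCB.Mem T c (fun t => P2 (q2 t) (u t)) (P2S Q2 U) := by
  have h := SCB.mem_neg (SCB.mem_mulI (SCB.mem_mulR h2 hu))
  exact h.congr fun t => by unfold P2; ring

/-- soundness of `PzS` [cite: Moore1966, §4.4] -/
theorem smem_Pz (h0 : SCB.Mem T c q0 Q0) (h1 : SCB.Mem T c q1 Q1) (h2 : SCB.Mem T c q2 Q2)
    (hu : SFI.Mem T c u U) (hz : SFI.Mem T c z Z) :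
    SCB.Mem T c (fun t => Pz (q0 t) (q1 t) (q2 t) (u t) (z t)) (PzS Q0 Q1 Q2 U Z) := by
  have h := SCB.mem_add (SCB.mem_add (smem_P0 h0 h1 h2 hu) (SCB.mem_mulR (smem_P1 h1 h2 hu) hz))
    (SCB.mem_mulR (smem_P2 h2 hu) (SFI.mem_mul hz hz))
  exact h.congr fun t => by unfold Pz; push_cast; ring

/-- slope mirror of `expQuadInt q₀ q₁ q₂ m L` (rational frequency `m`; the phase `mLπ` as the real
slope form `(m·L)·π`). [cite: Zhang2022LandauSiegel, §8 (8.13)–(8.22)] -/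
def expQuadIntS (Q0 Q1 Q2 : SCB) (m : ℚ) (L : SFI) (T : FI) (c : ℚ) : SCB :=
  ((PzS Q0 Q1 Q2 (SFI.const (overPiFI m⁻¹)) L).mul
      (SCB.expI ((L.scaleRat m).mul (SFI.const FI.pi)) T c)).sub
    (P0S Q0 Q1 Q2 (SFI.const (overPiFI m⁻¹)))

/-- validity flags of `expQuadIntS` [folklore] -/
def expQuadIntSOK (m : ℚ) (L : SFI) (T : FI) (c : ℚ) : Bool :=
  overPiOK m⁻¹ && SCB.expISOK ((L.scaleRat m).mul (SFI.const FI.pi)) T c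

/-- soundness of `expQuadIntS` [cite: Moore1966, §4.4] -/
theorem smem_expQuadInt (h0 : SCB.Mem T c q0 Q0) (h1 : SCB.Mem T c q1 Q1) (h2 : SCB.Mem T c q2 Q2)
    {m : ℚ} (hl : SFI.Mem T c l L) (h : expQuadIntSOK m L T c = true) :
    SCB.Mem T c (fun t => expQuadInt (q0 t) (q1 t) (q2 t) m (l t)) (expQuadIntS Q0 Q1 Q2 m L T c) := by
  simp only [expQuadIntSOK, Bool.and_eq_true] at h
  have hu : SFI.Mem T c (fun _ => overPi m⁻¹) (SFI.const (overPiFI m⁻¹)) :=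
    SFI.mem_const (mem_overPiFI h.1)
  have ha : SFI.Mem T c (fun t => (m : ℝ) * l t * π) ((L.scaleRat m).mul (SFI.const FI.pi)) :=
    SFI.mem_mul (SFI.mem_scaleRat hl m) (SFI.mem_const FI.mem_pi)
  have he := SCB.mem_expI ha h.2
  have hh := SCB.mem_sub (SCB.mem_mul (smem_Pz h0 h1 h2 hu hl) he) (smem_P0 h0 h1 h2 hu)
  exact hh.congr fun t => by unfold expQuadInt; push_cast; ring_nf

/-- slope mirror of `polyInt q₀ q₁ q₂ L` [cite: Zhang2022LandauSiegel, §8 (8.13)–(8.22)] -/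
def polyIntS (Q0 Q1 Q2 : SCB) (L : SFI) : SCB :=
  ((Q0.mulR L).add (((Q1.mulR (L.mul L)).mulR (SFI.const (FI.ofRat (1/2)))))).add
    ((Q2.mulR ((L.mul L).mul L)).mulR (SFI.const (FI.ofRat (1/3))))

/-- soundness of `polyIntS` [cite: Moore1966, §4.4] -/
theorem smem_polyInt (h0 : SCB.Mem T c q0 Q0) (h1 : SCB.Mem T c q1 Q1) (h2 : SCB.Mem T c q2 Q2)
    (hl : SFI.Mem T c l L) :
    SCB.Mem T c (fun t => polyInt (q0 t) (q1 t) (q2 t) (l t)) (polyIntS Q0 Q1 Q2 L) := by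
  have hh := SCB.mem_add (SCB.mem_add (SCB.mem_mulR h0 hl)
      (SCB.mem_mulR (SCB.mem_mulR h1 (SFI.mem_mul hl hl)) (SFI.mem_const (FI.mem_ofRat (1/2)))))
    (SCB.mem_mulR (SCB.mem_mulR h2 (SFI.mem_mul (SFI.mem_mul hl hl) hl))
      (SFI.mem_const (FI.mem_ofRat (1/3))))
  exact hh.congr fun t => by unfold polyInt; push_cast; ring

/-! ### The §8 integrals with the printed (rational) profiles -/

/-- constant coefficient box `r₀aπi` [folklore] -/
def coefA (r0 a : ℚ) : CB := (((qCB r0).mul (qCB a)).mulFI FI.pi).mulI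
/-- constant coefficient box `(ar₁ + b)πi` [folklore] -/
def coefB (a r1 b : ℚ) : CB := ((((qCB a).mul (qCB r1)).add (qCB b)).mulFI FI.pi).mulI
/-- constant coefficient box `ab(πi)²` [folklore] -/
def coefC (a b : ℚ) : CB := ((qCB a).mul (qCB b)).mul piISq

/-- `r₀aπi ∈ coefA` [cite: Moore1966, Theorem 3.1] -/
theorem mem_coefA (r0 a : ℚ) : CB.mem ((r0 : ℂ) * a * π * I) (coefA r0 a) := by
  unfold coefA; apply_rules [CB.mem_mulI, CB.mem_mulFI, CB.mem_mul, FI.mem_pi, mem_qCB]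
/-- `(ar₁ + b)πi ∈ coefB` [cite: Moore1966, Theorem 3.1] -/
theorem mem_coefB (a r1 b : ℚ) : CB.mem (((a : ℂ) * r1 + b) * π * I) (coefB a r1 b) := by
  unfold coefB; apply_rules [CB.mem_mulI, CB.mem_mulFI, CB.mem_mul, CB.mem_add, FI.mem_pi, mem_qCB]
/-- `ab(πi)² ∈ coefC` [cite: Moore1966, Theorem 3.1] -/
theorem mem_coefC (a b : ℚ) : CB.mem ((a : ℂ) * b * (π * I) ^ 2) (coefC a b) := by
  unfold coefC; apply_rules [CB.mem_mul, mem_qCB, mem_piISq]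

/-- slope mirror of `FGint a k r₀ r₁ b L` [cite: Zhang2022LandauSiegel, (8.19), (8.20), (9.3)] -/
def FGintS (a k r0 r1 b : ℚ) (L : SFI) (T : FI) (c : ℚ) : SCB :=
  (expQuadIntS (SCB.const (qCB r0)) (SCB.const (coefA r0 a)) (SCB.const (CB.ofInt 0)) k L T c).add
    (polyIntS (SCB.const (qCB r1)) (SCB.const (coefB a r1 b)) (SCB.const (coefC a b)) L)

/-- soundness of `FGintS` [cite: Moore1966, §4.4] -/
theorem smem_FGint {a k r0 r1 b : ℚ} (hl : SFI.Mem T c l L) (h : expQuadIntSOK k L T c = true) :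
    SCB.Mem T c (fun t => FGint a k r0 r1 b (l t)) (FGintS a k r0 r1 b L T c) := by
  have hh := SCB.mem_add
    (smem_expQuadInt (SCB.mem_const (mem_qCB r0)) (SCB.mem_const (mem_coefA r0 a))
      (SCB.mem_const mem_zeroCB) hl h)
    (smem_polyInt (SCB.mem_const (mem_qCB r1)) (SCB.mem_const (mem_coefB a r1 b))
      (SCB.mem_const (mem_coefC a b)) hl)
  exact hh.congr fun t => by unfold FGint; rfl

/-- slope mirror of `r₁ + bπis` [cite: Zhang2022LandauSiegel, (8.21)] -/
def shiftRS (r1 b : ℚ) (S : SFI) : SCB :=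
  (SCB.const (qCB r1)).add ((SCB.const (((qCB b).mulFI FI.pi).mulI)).mulR S)
/-- slope mirror of `1 + aπis` [cite: Zhang2022LandauSiegel, (8.22)] -/
def shiftUS (a : ℚ) (S : SFI) : SCB :=
  (SCB.const (CB.ofInt 1)).add ((SCB.const (((qCB a).mulFI FI.pi).mulI)).mulR S)

/-- soundness of `shiftRS` [cite: Moore1966, §4.4] -/
theorem smem_shiftR (r1 b : ℚ) (hs : SFI.Mem T c s S) :
    SCB.Mem T c (fun t => (r1 : ℂ) + b * π * I * (s t : ℝ)) (shiftRS r1 b S) := by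
  have hb : CB.mem ((b : ℂ) * π * I) (((qCB b).mulFI FI.pi).mulI) := by
    apply_rules [CB.mem_mulI, CB.mem_mulFI, FI.mem_pi, mem_qCB]
  have hh := SCB.mem_add (SCB.mem_const (mem_qCB r1)) (SCB.mem_mulR (SCB.mem_const hb) hs)
  exact hh.congr fun t => by ring

/-- soundness of `shiftUS` [cite: Moore1966, §4.4] -/
theorem smem_shiftU (a : ℚ) (hs : SFI.Mem T c s S) :
    SCB.Mem T c (fun t => (1 : ℂ) + a * π * I * (s t : ℝ)) (shiftUS a S) := by
  have hb : CB.mem ((a : ℂ) * π * I) (((qCB a).mulFI FI.pi).mulI) := by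
    apply_rules [CB.mem_mulI, CB.mem_mulFI, FI.mem_pi, mem_qCB]
  have hh := SCB.mem_add (SCB.mem_const mem_oneCB) (SCB.mem_mulR (SCB.mem_const hb) hs)
  exact hh.congr fun t => by ring

/-- slope mirror of `FGXint a k r₀ r₁ b k' L s` (both `L` and the shift `s` may move with `t`).
[cite: Zhang2022LandauSiegel, (8.21), (9.6)] -/
def FGXintS (a k r0 r1 b k' : ℚ) (L S : SFI) (T : FI) (c : ℚ) : SCB :=
  (expQuadIntS (SCB.const (qCB r0)) (SCB.const (coefA r0 a)) (SCB.const (CB.ofInt 0)) k L T c).add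
    ((SCB.expI ((S.scaleRat (-k')).mul (SFI.const FI.pi)) T c).mul
      (expQuadIntS (shiftRS r1 b S)
        (((((SCB.const (qCB a)).mul (shiftRS r1 b S)).add (SCB.const (qCB b))).mulR
          (SFI.const FI.pi)).mulI)
        (SCB.const (coefC a b)) (k - k') L T c))

/-- validity flags of `FGXintS` [folklore] -/
def FGXintSOK (k k' : ℚ) (L S : SFI) (T : FI) (c : ℚ) : Bool :=
  expQuadIntSOK k L T c && expQuadIntSOK (k - k') L T c
    && SCB.expISOK ((S.scaleRat (-k')).mul (SFI.const FI.pi)) T c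

/-- soundness of `FGXintS` [cite: Moore1966, §4.4] -/
theorem smem_FGXint {a k r0 r1 b k' : ℚ} (hl : SFI.Mem T c l L) (hs : SFI.Mem T c s S)
    (h : FGXintSOK k k' L S T c = true) :
    SCB.Mem T c (fun t => FGXint a k r0 r1 b k' (l t) (s t)) (FGXintS a k r0 r1 b k' L S T c) := by
  simp only [FGXintSOK, Bool.and_eq_true] at h
  obtain ⟨⟨hE1, hE2⟩, hS⟩ := h
  have ha : SFI.Mem T c (fun t => ((-k' : ℚ) : ℝ) * s t * π) ((S.scaleRat (-k')).mul (SFI.const FI.pi)) :=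
    SFI.mem_mul (SFI.mem_scaleRat hs (-k')) (SFI.mem_const FI.mem_pi)
  have he := SCB.mem_expI ha hS
  have hR := smem_shiftR r1 b hs
  have hq1 : SCB.Mem T c (fun t => ((a : ℂ) * ((r1 : ℂ) + b * π * I * (s t : ℝ)) + b) * π * I)
      (((((SCB.const (qCB a)).mul (shiftRS r1 b S)).add (SCB.const (qCB b))).mulR
        (SFI.const FI.pi)).mulI) := by
    have := SCB.mem_mulI (SCB.mem_mulR (SCB.mem_add (SCB.mem_mul (SCB.mem_const (mem_qCB a)) hR)
      (SCB.mem_const (mem_qCB b))) (SFI.mem_const FI.mem_pi))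
    exact this.congr fun t => by ring
  have hh := SCB.mem_add
    (smem_expQuadInt (SCB.mem_const (mem_qCB r0)) (SCB.mem_const (mem_coefA r0 a))
      (SCB.mem_const mem_zeroCB) hl hE1)
    (SCB.mem_mul he (smem_expQuadInt hR hq1 (SCB.mem_const (mem_coefC a b)) hl hE2))
  exact hh.congr fun t => by unfold FGXint; push_cast; ring_nf

/-- slope mirror of `FGYint a k r₀ r₁ b k' L s`. [cite: Zhang2022LandauSiegel, (8.22), (9.5)] -/
def FGYintS (a k r0 r1 b k' : ℚ) (L S : SFI) (T : FI) (c : ℚ) : SCB :=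
  (SCB.expI ((S.scaleRat k).mul (SFI.const FI.pi)) T c).mul
    ((expQuadIntS ((SCB.const (qCB r0)).mul (shiftUS a S)) (SCB.const (coefA r0 a))
        (SCB.const (CB.ofInt 0)) k L T c).add
      (expQuadIntS ((shiftUS a S).mul (SCB.const (qCB r1)))
        (((((shiftUS a S).mul (SCB.const (qCB b))).add (SCB.const ((qCB a).mul (qCB r1)))).mulR
          (SFI.const FI.pi)).mulI)
        (SCB.const (coefC a b)) (k - k') L T c))

/-- validity flags of `FGYintS` [folklore] -/
def FGYintSOK (k k' : ℚ) (L S : SFI) (T : FI) (c : ℚ) : Bool :=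
  expQuadIntSOK k L T c && expQuadIntSOK (k - k') L T c
    && SCB.expISOK ((S.scaleRat k).mul (SFI.const FI.pi)) T c

/-- soundness of `FGYintS` [cite: Moore1966, §4.4] -/
theorem smem_FGYint {a k r0 r1 b k' : ℚ} (hl : SFI.Mem T c l L) (hs : SFI.Mem T c s S)
    (h : FGYintSOK k k' L S T c = true) :
    SCB.Mem T c (fun t => FGYint a k r0 r1 b k' (l t) (s t)) (FGYintS a k r0 r1 b k' L S T c) := by
  simp only [FGYintSOK, Bool.and_eq_true] at h
  obtain ⟨⟨hE1, hE2⟩, hS⟩ := h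
  have ha : SFI.Mem T c (fun t => ((k : ℚ) : ℝ) * s t * π) ((S.scaleRat k).mul (SFI.const FI.pi)) :=
    SFI.mem_mul (SFI.mem_scaleRat hs k) (SFI.mem_const FI.mem_pi)
  have he := SCB.mem_expI ha hS
  have hU := smem_shiftU a hs
  have hq0 := SCB.mem_mul (SCB.mem_const (mem_qCB r0)) hU
  have hq0' := SCB.mem_mul hU (SCB.mem_const (mem_qCB r1))
  have har : CB.mem ((a : ℂ) * r1) ((qCB a).mul (qCB r1)) := CB.mem_mul (mem_qCB a) (mem_qCB r1)
  have hq1 : SCB.Mem T c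
      (fun t => (((1 : ℂ) + a * π * I * (s t : ℝ)) * b + a * r1) * π * I)
      (((((shiftUS a S).mul (SCB.const (qCB b))).add (SCB.const ((qCB a).mul (qCB r1)))).mulR
        (SFI.const FI.pi)).mulI) := by
    have := SCB.mem_mulI (SCB.mem_mulR (SCB.mem_add (SCB.mem_mul hU (SCB.mem_const (mem_qCB b)))
      (SCB.mem_const har)) (SFI.mem_const FI.mem_pi))
    exact this.congr fun t => by ring
  have hh := SCB.mem_mul he (SCB.mem_add
    (smem_expQuadInt hq0 (SCB.mem_const (mem_coefA r0 a)) (SCB.mem_const mem_zeroCB) hl hE1)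
    (smem_expQuadInt hq0' hq1 (SCB.mem_const (mem_coefC a b)) hl hE2))
  exact hh.congr fun t => by unfold FGYint; push_cast; ring_nf

/-! ### The pair block -/

/-- `1/(xπ)` of a real slope form [cite: Moore1966, §4.4] -/
def invMulPiS (X : SFI) : SFI := (X.mul (SFI.const FI.pi)).recip
/-- validity flag [folklore] -/
def invMulPiSOK (X : SFI) : Bool := (X.mul (SFI.const FI.pi)).recipSOK

/-- soundness of `invMulPiS` [cite: Moore1966, §4.4] -/
theorem smem_invMulPi {x : ℝ → ℝ} {X : SFI} (hx : SFI.Mem T c x X) (h : invMulPiSOK X = true) :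
    SFI.Mem T c (fun t => invMulPi (x t)) (invMulPiS X) := by
  have := SFI.mem_recip (SFI.mem_mul hx (SFI.mem_const FI.mem_pi)) h
  exact this.congr fun t => by unfold invMulPi; rfl

/-- slope mirror of `bDiagVal k ν` for a length slope form `V` [cite: Zhang2022LandauSiegel, (8.19), (8.20), (9.3)] -/
def bDiagValS (k : ℚ) (V : SFI) (T : FI) (c : ℚ) : SCB :=
  ((((SCB.const (qCB (1/2))).mul (FGintS (k - 1) k (r0Main k 2 3) (1 - r0Main k 2 3) (bMain k 2 3) V T c)).add
    ((SCB.const (qCB 2)).mul (FGintS (k - 2) k (r0Main k 3 1) (1 - r0Main k 3 1) (bMain k 3 1) V T c))).add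
    ((SCB.const (qCB (3/2))).mul (FGintS (k - 3) k (r0Main k 1 2) (1 - r0Main k 1 2) (bMain k 1 2) V T c))).mulR
  (invMulPiS (V.mul V))

/-- validity flags of `bDiagValS` [folklore] -/
def bDiagValSOK (k : ℚ) (V : SFI) (T : FI) (c : ℚ) : Bool :=
  expQuadIntSOK k V T c && invMulPiSOK (V.mul V)

variable {ν νL νS : ℝ → ℝ} {V VL VS : SFI}

/-- soundness of `bDiagValS` (as a slope form of `t ↦ bDiag k (ν t)`, `k ≠ 0`). [cite: Moore1966, §4.4] -/
theorem smem_bDiag {k : ℚ} (hk : k ≠ 0) (hν : SFI.Mem T c ν V) (h : bDiagValSOK k V T c = true) :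
    SCB.Mem T c (fun t => bDiag k (ν t)) (bDiagValS k V T c) := by
  simp only [bDiagValSOK, Bool.and_eq_true] at h
  have hp := smem_invMulPi (SFI.mem_mul hν hν) h.2
  have hh := SCB.mem_mulR (SCB.mem_add (SCB.mem_add
    (SCB.mem_mul (SCB.mem_const (mem_qCB (1/2))) (smem_FGint (a := k - 1) (r0 := r0Main k 2 3)
      (r1 := 1 - r0Main k 2 3) (b := bMain k 2 3) hν h.1))
    (SCB.mem_mul (SCB.mem_const (mem_qCB 2)) (smem_FGint (a := k - 2) (r0 := r0Main k 3 1)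
      (r1 := 1 - r0Main k 3 1) (b := bMain k 3 1) hν h.1)))
    (SCB.mem_mul (SCB.mem_const (mem_qCB (3/2))) (smem_FGint (a := k - 3) (r0 := r0Main k 1 2)
      (r1 := 1 - r0Main k 1 2) (b := bMain k 1 2) hν h.1))) hp
  exact hh.congr fun t => by rw [bDiag_eq_val k hk]; unfold bDiagVal; rfl

/-- slope mirror of `bCrossYVal kL kS νL νS` [cite: Zhang2022LandauSiegel, (8.22), (9.5)] -/
def bCrossYValS (kL kS : ℚ) (VL VS : SFI) (T : FI) (c : ℚ) : SCB :=
  ((((SCB.const (qCB (1/2))).mul (FGYintS (kL - 1) kL (r0Main kS 2 3) (1 - r0Main kS 2 3) (bMain kS 2 3) kS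
      VS (VL.sub VS) T c)).add
    ((SCB.const (qCB 2)).mul (FGYintS (kL - 2) kL (r0Main kS 3 1) (1 - r0Main kS 3 1) (bMain kS 3 1) kS
      VS (VL.sub VS) T c))).add
    ((SCB.const (qCB (3/2))).mul (FGYintS (kL - 3) kL (r0Main kS 1 2) (1 - r0Main kS 1 2) (bMain kS 1 2) kS
      VS (VL.sub VS) T c))).mulR
  (invMulPiS (VL.mul VS))

/-- validity flags of `bCrossYValS` [folklore] -/
def bCrossYValSOK (kL kS : ℚ) (VL VS : SFI) (T : FI) (c : ℚ) : Bool :=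
  FGYintSOK kL kS VS (VL.sub VS) T c && invMulPiSOK (VL.mul VS)

/-- soundness of `bCrossYValS` (`k_L ≠ 0`, `k_L ≠ k_S`). [cite: Moore1966, §4.4] -/
theorem smem_bCrossY {kL kS : ℚ} (hL : kL ≠ 0) (hLS : kL - kS ≠ 0) (hνL : SFI.Mem T c νL VL)
    (hνS : SFI.Mem T c νS VS) (h : bCrossYValSOK kL kS VL VS T c = true) :
    SCB.Mem T c (fun t => bCrossY kL kS (νL t) (νS t)) (bCrossYValS kL kS VL VS T c) := by
  simp only [bCrossYValSOK, Bool.and_eq_true] at h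
  have hp := smem_invMulPi (SFI.mem_mul hνL hνS) h.2
  have hs := SFI.mem_sub hνL hνS
  have hh := SCB.mem_mulR (SCB.mem_add (SCB.mem_add
    (SCB.mem_mul (SCB.mem_const (mem_qCB (1/2))) (smem_FGYint (a := kL - 1) (r0 := r0Main kS 2 3)
      (r1 := 1 - r0Main kS 2 3) (b := bMain kS 2 3) hνS hs h.1))
    (SCB.mem_mul (SCB.mem_const (mem_qCB 2)) (smem_FGYint (a := kL - 2) (r0 := r0Main kS 3 1)
      (r1 := 1 - r0Main kS 3 1) (b := bMain kS 3 1) hνS hs h.1)))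
    (SCB.mem_mul (SCB.mem_const (mem_qCB (3/2))) (smem_FGYint (a := kL - 3) (r0 := r0Main kS 1 2)
      (r1 := 1 - r0Main kS 1 2) (b := bMain kS 1 2) hνS hs h.1))) hp
  exact hh.congr fun t => by rw [bCrossY_eq_val kL kS hL hLS]; unfold bCrossYVal; rfl

/-- slope mirror of `bCrossXVal kL kS νL νS` [cite: Zhang2022LandauSiegel, (8.21), (9.6)] -/
def bCrossXValS (kL kS : ℚ) (VL VS : SFI) (T : FI) (c : ℚ) : SCB :=
  ((((SCB.const (qCB (1/2))).mul (FGXintS (kS - 1) kS (r0Main kL 2 3) (1 - r0Main kL 2 3) (bMain kL 2 3) kL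
      VS (VL.sub VS) T c)).add
    ((SCB.const (qCB 2)).mul (FGXintS (kS - 2) kS (r0Main kL 3 1) (1 - r0Main kL 3 1) (bMain kL 3 1) kL
      VS (VL.sub VS) T c))).add
    ((SCB.const (qCB (3/2))).mul (FGXintS (kS - 3) kS (r0Main kL 1 2) (1 - r0Main kL 1 2) (bMain kL 1 2) kL
      VS (VL.sub VS) T c))).mulR
  (invMulPiS (VL.mul VS))

/-- validity flags of `bCrossXValS` [folklore] -/
def bCrossXValSOK (kL kS : ℚ) (VL VS : SFI) (T : FI) (c : ℚ) : Bool :=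
  FGXintSOK kS kL VS (VL.sub VS) T c && invMulPiSOK (VL.mul VS)

/-- soundness of `bCrossXValS` (`k_S ≠ 0`, `k_S ≠ k_L`). [cite: Moore1966, §4.4] -/
theorem smem_bCrossX {kL kS : ℚ} (hS : kS ≠ 0) (hSL : kS - kL ≠ 0) (hνL : SFI.Mem T c νL VL)
    (hνS : SFI.Mem T c νS VS) (h : bCrossXValSOK kL kS VL VS T c = true) :
    SCB.Mem T c (fun t => bCrossX kL kS (νL t) (νS t)) (bCrossXValS kL kS VL VS T c) := by
  simp only [bCrossXValSOK, Bool.and_eq_true] at h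
  have hp := smem_invMulPi (SFI.mem_mul hνL hνS) h.2
  have hs := SFI.mem_sub hνL hνS
  have hh := SCB.mem_mulR (SCB.mem_add (SCB.mem_add
    (SCB.mem_mul (SCB.mem_const (mem_qCB (1/2))) (smem_FGXint (a := kS - 1) (r0 := r0Main kL 2 3)
      (r1 := 1 - r0Main kL 2 3) (b := bMain kL 2 3) hνS hs h.1))
    (SCB.mem_mul (SCB.mem_const (mem_qCB 2)) (smem_FGXint (a := kS - 2) (r0 := r0Main kL 3 1)
      (r1 := 1 - r0Main kL 3 1) (b := bMain kL 3 1) hνS hs h.1)))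
    (SCB.mem_mul (SCB.mem_const (mem_qCB (3/2))) (smem_FGXint (a := kS - 3) (r0 := r0Main kL 1 2)
      (r1 := 1 - r0Main kL 1 2) (b := bMain kL 1 2) hνS hs h.1))) hp
  exact hh.congr fun t => by rw [bCrossX_eq_val kL kS hS hSL]; unfold bCrossXVal; rfl

/-- slope mirror of `cDiag k ν = b + b̄` [cite: Zhang2022LandauSiegel, §8 after (8.23)] -/
def cDiagS (k : ℚ) (V : SFI) (T : FI) (c : ℚ) : SCB := (bDiagValS k V T c).add (bDiagValS k V T c).conj

/-- soundness of `cDiagS` [cite: Moore1966, §4.4] -/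
theorem smem_cDiag {k : ℚ} (hk : k ≠ 0) (hν : SFI.Mem T c ν V) (h : bDiagValSOK k V T c = true) :
    SCB.Mem T c (fun t => cDiag k (ν t)) (cDiagS k V T c) := by
  have hb := smem_bDiag hk hν h
  exact (SCB.mem_add hb (SCB.mem_conj hb)).congr fun t => by unfold cDiag; rfl

/-- slope mirror of `cCross kL kS νL νS = b_Y + b̄_X` [cite: Zhang2022LandauSiegel, §8 after (8.23), §9 after (9.7)] -/
def cCrossS (kL kS : ℚ) (VL VS : SFI) (T : FI) (c : ℚ) : SCB :=
  (bCrossYValS kL kS VL VS T c).add (bCrossXValS kL kS VL VS T c).conj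

/-- validity flags of `cCrossS` [folklore] -/
def cCrossSOK (kL kS : ℚ) (VL VS : SFI) (T : FI) (c : ℚ) : Bool :=
  bCrossYValSOK kL kS VL VS T c && bCrossXValSOK kL kS VL VS T c

/-- soundness of `cCrossS` (`k_L, k_S ≠ 0`, `k_L ≠ k_S`). [cite: Moore1966, §4.4] -/
theorem smem_cCross {kL kS : ℚ} (hL : kL ≠ 0) (hS : kS ≠ 0) (hLS : kL ≠ kS)
    (hνL : SFI.Mem T c νL VL) (hνS : SFI.Mem T c νS VS) (h : cCrossSOK kL kS VL VS T c = true) :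
    SCB.Mem T c (fun t => cCross kL kS (νL t) (νS t)) (cCrossS kL kS VL VS T c) := by
  simp only [cCrossSOK, Bool.and_eq_true] at h
  have hY := smem_bCrossY hL (sub_ne_zero.2 hLS) hνL hνS h.1
  have hX := smem_bCrossX hS (sub_ne_zero.2 (Ne.symm hLS)) hνL hνS h.2
  exact (SCB.mem_add hY (SCB.mem_conj hX)).congr fun t => by unfold cCross; rfl

end Literature.NumberTheory.LFunctions.Zhang2022
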